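/-
Copyright (c) 2026 the pub-hodgecm-mathlib formalisation cell (harness21).  Prover seat hodgecm-mathlib-K2E1-p12 (g2), Track B ∕ K2-LIT, h413 = `stmt-HodgeConjecture-24833`,
line `K2_E1_TraceFormulaBeta`, dealer K2E1-plan (g7) (232)∕(238)∕(241) «F3d-α», file α-2a: the FAMILY (action-free) edition of ★ F3c `K2E1CompactAbelianIsotypicApproximationU` —
the Fejér approximation with ONE finite set of characters and ONE coefficient vector for a whole equicontinuous, uniformly bounded family of continuous functions on a compact abelian group.
-/
import Summits.HodgeConjecture.HodgeConjecture.Theorems.K2E1CompactAbelianIsotypicApproximationU   -- ★ F3c: `integrable_of_continuous`, `exists_finset_character_sup_approx` (trig. polynomials sup-dense)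
import HarnessLib

/-!
# K2·E1 — `K2E1CompactAbelianFamilyApproximationU` (F3d-α, file α-2a): Fejér approximation for an EQUICONTINUOUS BOUNDED FAMILY on a compact abelian group

Track B ∕ K2-LIT, crux h413 = `stmt-HodgeConjecture-24833`, route `HCCMUnconditional`; cell `hodgecm-mathlib`, squad K2, ENGINE E1, ROADCARD C7 «families».  THEOREMS ONLY (no `def`,
no `instance`, no notation, no named-fact hypothesis, no `sorry`); lane `--supports stmt-HodgeConjecture-24833 --as helper` (count-neutral).  Closes no socket.

WHY.  ★ F3c's head `exists_finset_character_isotypic_approx` needs a `MulAction C X` and a compactly supported `ψ` on `X`; the pseudo-Eisenstein families of K2E1-p10 (g2)'s `hα` (★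
p860399) live on `G = U(1,1)(𝔸_F)` where neither is available without building the quotient `N(𝔸)B(F)∖G`.  What the Fejér argument really uses is only: a family `c ↦ Φ(c, y)` of
continuous functions on `C` (indexed by `y : Y`, no structure on `Y`), UNIFORMLY BOUNDED (`‖Φ(c, y)‖ ≤ M`) and EQUICONTINUOUS AT `1` (`‖Φ(c, y) − Φ(1, y)‖ ≤ ε∕2` for `c` in a fixed
neighbourhood `u ∋ 1` and all `y`).  Then ONE finite set `s` of characters and ONE coefficient vector `a` give `‖Φ(1, y) − Σ_{χ ∈ s} a χ · ∫ χ̄(c) Φ(c, y) dc‖ ≤ ε` for ALL `y` (§1), by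
★ F3c's proof verbatim: Urysohn bump at `1` inside `u`, normalised; a trigonometric polynomial sup-close to it (★ `exists_finset_character_sup_approx`); two estimates.
* §1 HEAD **`exists_finset_character_family_approx`**.
HONEST LABEL: HC_CM is proved only modulo the 7 printed citations (2 remaining named inputs: hLiu418 = `stmt-HodgeConjecture-24832`, h413 = `stmt-HodgeConjecture-24833`) until rung 0
closes; this file is letter-free functional analysis and closes no socket.
References: [DeitmarEchterhoff2014] Prop. 3.5.2 · [Folland1995] §4.2, Thm. 5.11 · [BrockerTomDieck1985] III (5.1), (5.10).
-/

set_option autoImplicit false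
-- the mandated namespace repeats the single-problem summit's segment (`HodgeConjecture.HodgeConjecture`)
set_option linter.dupNamespace false

noncomputable section

open MeasureTheory Set Filter Topology
open Summit.HodgeConjecture.HodgeConjecture.Cruxes.H413.K2E1CompactAbelianIsotypicApproximationU

namespace Summit.HodgeConjecture.HodgeConjecture.Cruxes.H413.K2E1CompactAbelianFamilyApproximationU

variable {C : Type*} [CommGroup C] [TopologicalSpace C] [IsTopologicalGroup C] [CompactSpace C] [T2Space C] [MeasurableSpace C] [BorelSpace C]
  (μC : Measure C) [IsProbabilityMeasure μC] [μC.IsMulLeftInvariant]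

/-! ## §1 Fejér approximation, uniformly over an equicontinuous bounded family -/

/-- **FEJÉR FOR FAMILIES.**  `C` compact Hausdorff abelian, `μC` a left-invariant probability measure; `Φ : C → Y → ℂ` with every `Φ(·, y)` continuous, `‖Φ(c, y)‖ ≤ M`, and
`‖Φ(c, y) − Φ(1, y)‖ ≤ ε∕2` for `c` in an open `u ∋ 1` and all `y`.  Then there are a finite set `s` of unitary characters and coefficients `a` with
`‖Φ(1, y) − Σ_{χ ∈ s} a χ · ∫ conj(χ c) Φ(c, y) dμC‖ ≤ ε` for EVERY `y`. [cite: DeitmarEchterhoff2014, Prop. 3.5.2] [cite: Folland1995, Thm. 5.11] -/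
theorem exists_finset_character_family_approx {Y : Type*} {Φ : C → Y → ℂ} (hΦc : ∀ y, Continuous fun c => Φ c y) {M : ℝ} (hM' : ∀ c y, ‖Φ c y‖ ≤ M)
    {ε : ℝ} (hε : 0 < ε) {u : Set C} (hu : IsOpen u) (h1u : (1 : C) ∈ u) (hU : ∀ c ∈ u, ∀ y, ‖Φ c y - Φ 1 y‖ ≤ ε / 2) :
    ∃ (s : Finset (PontryaginDual C)) (a : PontryaginDual C → ℂ),
      ∀ y : Y, ‖Φ 1 y - ∑ χ ∈ s, a χ * ∫ c, star ((χ c : Circle) : ℂ) * Φ c y ∂μC‖ ≤ ε := by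
  classical
  haveI : μC.IsOpenPosMeasure := isOpenPosMeasure_of_mulLeftInvariant_of_compact Set.univ isCompact_univ (by rw [measure_univ]; exact one_ne_zero)
  -- a nonnegative sup bound
  set M₀ : ℝ := max M 0 with hMdef
  have hM : ∀ c y, ‖Φ c y‖ ≤ M₀ := fun c y => (hM' c y).trans (le_max_left _ _)
  have hM0 : 0 ≤ M₀ := le_max_right _ _
  -- an Urysohn bump at `1` supported in `u`, normalised
  obtain ⟨b, hb1, hb0, -, hb01⟩ := exists_continuous_one_zero_of_isCompact (isCompact_singleton : IsCompact ({1} : Set C)) hu.isClosed_compl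
    (Set.disjoint_singleton_left.2 fun h => h h1u)
  have hbnn : ∀ c, 0 ≤ b c := fun c => (hb01 c).1
  have hbu : ∀ c, b c ≠ 0 → c ∈ u := fun c hc => by
    by_contra hcu
    exact hc (hb0 hcu)
  set I : ℝ := ∫ c, b c ∂μC with hIdef
  have hIpos : 0 < I := b.continuous.integral_pos_of_hasCompactSupport_nonneg_nonzero (HasCompactSupport.of_compactSpace _) hbnn
    (x := 1) (by rw [hb1 (Set.mem_singleton 1)]; exact one_ne_zero)
  set g : C(C, ℂ) := ⟨fun c => ((b c / I : ℝ) : ℂ), Complex.continuous_ofReal.comp (b.continuous.div_const I)⟩ with hgdef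
  have hg_apply : ∀ c, g c = ((b c / I : ℝ) : ℂ) := fun c => rfl
  have hgint : ∫ c, g c ∂μC = 1 := by
    simp only [hg_apply]
    rw [integral_complex_ofReal, integral_div, ← hIdef, div_self hIpos.ne', Complex.ofReal_one]
  -- a trigonometric polynomial close to `g`
  set δ : ℝ := ε / (2 * (M₀ + 1)) with hδdef
  have hδ : 0 < δ := by rw [hδdef]; positivity
  obtain ⟨s, a, hpa⟩ := exists_finset_character_sup_approx g hδ
  refine ⟨s.image (·⁻¹), fun χ => a χ⁻¹, fun y => ?_⟩
  -- integrability facts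
  have hint1 : ∀ χ : PontryaginDual C, Integrable (fun c => star ((χ c : Circle) : ℂ) * Φ c y) μC := fun χ =>
    integrable_of_continuous μC ((continuous_star.comp (continuous_subtype_val.comp (map_continuous χ))).mul (hΦc y))
  have hintg : Integrable (fun c => g c * Φ c y) μC := integrable_of_continuous μC (g.continuous.mul (hΦc y))
  have hintp : Integrable (fun c => (∑ χ ∈ s, a χ * ((χ c : Circle) : ℂ)) * Φ c y) μC :=
    integrable_of_continuous μC ((continuous_finsetSum _ fun χ _ => continuous_const.mul (continuous_subtype_val.comp (map_continuous χ))).mul (hΦc y))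
  -- the finite sum of projections is the integral against the trigonometric polynomial
  have hsum : ∑ χ ∈ s.image (·⁻¹), a χ⁻¹ * ∫ c, star ((χ c : Circle) : ℂ) * Φ c y ∂μC = ∫ c, (∑ χ ∈ s, a χ * ((χ c : Circle) : ℂ)) * Φ c y ∂μC := by
    rw [Finset.sum_image (fun χ _ χ' _ h => inv_injective h)]
    simp only [inv_inv]
    have h1 : ∀ χ ∈ s, a χ * ∫ c, star (((χ⁻¹ : PontryaginDual C) c : Circle) : ℂ) * Φ c y ∂μC = ∫ c, a χ * ((χ c : Circle) : ℂ) * Φ c y ∂μC := by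
      intro χ _
      rw [← integral_const_mul]
      refine integral_congr_ae (Filter.Eventually.of_forall fun c => ?_)
      have : star (((χ⁻¹ : PontryaginDual C) c : Circle) : ℂ) = ((χ c : Circle) : ℂ) := by
        rw [show (χ⁻¹ : PontryaginDual C) c = (χ c)⁻¹ from rfl, Circle.coe_inv_eq_conj, Complex.star_def, Complex.conj_conj]
      simp only [this, mul_assoc]
    rw [Finset.sum_congr rfl h1]
    symm
    simp_rw [Finset.sum_mul]
    exact integral_finsetSum _ fun χ _ => integrable_of_continuous μC ((continuous_const.mul (continuous_subtype_val.comp (map_continuous χ))).mul (hΦc y))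
  rw [hsum]
  -- the two estimates
  have hA : ‖Φ 1 y - ∫ c, g c * Φ c y ∂μC‖ ≤ ε / 2 := by
    have hrepr : Φ 1 y - ∫ c, g c * Φ c y ∂μC = ∫ c, g c * (Φ 1 y - Φ c y) ∂μC := by
      have h1 : ∫ c, g c * (Φ 1 y - Φ c y) ∂μC = (∫ c, g c ∂μC) * Φ 1 y - ∫ c, g c * Φ c y ∂μC := by
        rw [← integral_mul_const, ← integral_sub ((integrable_of_continuous μC g.continuous).mul_const _) hintg]
        exact integral_congr_ae (Filter.Eventually.of_forall fun c => by simp only [mul_sub])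
      rw [h1, hgint, one_mul]
    rw [hrepr]
    calc ‖∫ c, g c * (Φ 1 y - Φ c y) ∂μC‖ ≤ ∫ c, ‖g c * (Φ 1 y - Φ c y)‖ ∂μC := norm_integral_le_integral_norm _
      _ ≤ ∫ c, b c / I * (ε / 2) ∂μC := by
          refine integral_mono_of_nonneg (Filter.Eventually.of_forall fun c => norm_nonneg _)
            (integrable_of_continuous μC ((b.continuous.div_const I).mul continuous_const)) (Filter.Eventually.of_forall fun c => ?_)
          · show ‖g c * (Φ 1 y - Φ c y)‖ ≤ b c / I * (ε / 2)
            rw [norm_mul, hg_apply, Complex.norm_real, Real.norm_of_nonneg (div_nonneg (hbnn c) hIpos.le)]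
            by_cases hbc : b c = 0
            · rw [hbc, zero_div, zero_mul, zero_mul]
            · rw [norm_sub_rev]
              exact mul_le_mul_of_nonneg_left (hU c (hbu c hbc) y) (div_nonneg (hbnn c) hIpos.le)
      _ = ε / 2 := by rw [integral_mul_const, integral_div, ← hIdef, div_self hIpos.ne', one_mul]
  have hB : ‖(∫ c, g c * Φ c y ∂μC) - ∫ c, (∑ χ ∈ s, a χ * ((χ c : Circle) : ℂ)) * Φ c y ∂μC‖ ≤ ε / 2 := by
    rw [← integral_sub hintg hintp]
    calc ‖∫ c, (g c * Φ c y - (∑ χ ∈ s, a χ * ((χ c : Circle) : ℂ)) * Φ c y) ∂μC‖ ≤ δ * M₀ * μC.real Set.univ :=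
          norm_integral_le_of_norm_le_const (Filter.Eventually.of_forall fun c => by
            rw [← sub_mul, norm_mul]
            exact mul_le_mul (hpa c) (hM _ _) (norm_nonneg _) hδ.le)
      _ = δ * M₀ := by rw [probReal_univ, mul_one]
      _ ≤ ε / 2 := by
          rw [hδdef, div_mul_eq_mul_div, div_le_div_iff₀ (by positivity) (by norm_num : (0:ℝ) < 2)]
          nlinarith [hM0, hε]
  calc ‖Φ 1 y - ∫ c, (∑ χ ∈ s, a χ * ((χ c : Circle) : ℂ)) * Φ c y ∂μC‖
      = ‖(Φ 1 y - ∫ c, g c * Φ c y ∂μC) + ((∫ c, g c * Φ c y ∂μC) - ∫ c, (∑ χ ∈ s, a χ * ((χ c : Circle) : ℂ)) * Φ c y ∂μC)‖ := by rw [sub_add_sub_cancel]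
    _ ≤ ε / 2 + ε / 2 := (norm_add_le _ _).trans (add_le_add hA hB)
    _ = ε := by ring

end Summit.HodgeConjecture.HodgeConjecture.Cruxes.H413.K2E1CompactAbelianFamilyApproximationU
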